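import Mathlib.Analysis.Calculus.Deriv.MeanValue
import Mathlib.Analysis.Calculus.LocalExtr.Basic
import Mathlib.Analysis.Calculus.ContDiff.Basic
import Mathlib.Analysis.Calculus.Deriv.Pow
import Mathlib.Analysis.Calculus.Deriv.Mul
import Literature.Analysis.Calculus.LineRestrictionIteratedDeriv
import HarnessLib

/-!
# Route `SwapVirialDeficit` (YangMills): A POINTWISE FLOOR THAT TOUCHES AT A MINIMUM IS A HESSIAN FLOOR
# (cell ym-idea-1, skeleton ➎; brick of w2 g60's memo3 §2/§4 for `stub_core_tip` — the FLOOR half of the Hessian sandwich at the flat base point: from w3's pointwise letter floors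
# `F̂ ≥ f_u + f_w + f_rel + f_z + …` (all vanishing to second order at `η₀`) one gets `D²F̂(η₀) ≥ D²f(η₀)` as quadratic forms;
# free-hands support of ⟨stmt-QuantumFields-24197⟩ `SwapVirialDeficit.SwapGluedStiffness`)

* §1 `iteratedDeriv_two_nonneg_of_isMinOn` — a `C²` function `φ : ℝ → ℝ` with a global minimum at `0` has `φ″(0) ≥ 0` (two mean-value steps; no Taylor polynomial API).
* §2 ★★ `hessianForm_le_of_le_of_eq` — `F, g : V → ℝ` of class `C²`, `g ≤ F` everywhere and `g x₀ = F x₀`: `D²g(x₀)[v,v] ≤ D²F(x₀)[v,v]` for every `v`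
  (apply §1 to `t ↦ (F − g)(x₀ + t v)`, ✓`iteratedDeriv_lineRestriction`).

HONEST LABEL: elementary calculus; `stub_core_tip` and the other stubs, ⟨24197⟩ ∕ ⟨24194⟩ OPEN; own crux ⟨22884⟩ `LargeFieldMassRefinementTail` OPEN (blocked-on ⟨19935⟩); the Yang–Mills
mass gap is NOT proved; no summit is proved by a line.  THEOREMS ONLY (0 `def`, 0 `sorry`), standard axioms.  Width seat ym-line-sfw-p2-w2 g60 (cell ym-idea-1, free hands),
`--supports stmt-QuantumFields-24197`.  References: [folklore].
-/

set_option autoImplicit false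

noncomputable section

open Set

namespace Summit.QuantumFields.YangMills.Theorems.QuantitativeLaplace

/-! ## §1 One variable: a `C²` minimum has non-negative second derivative -/

/-- ★ A `C²` function on `ℝ` with a global minimum at `0` has `iteratedDeriv 2 φ 0 ≥ 0` (if it were negative, `φ″ < 0` near `0`, and two mean-value steps from `φ′(0) = 0`
would make `φ(t) < φ(0)` for small `t > 0`). [folklore] -/
theorem iteratedDeriv_two_nonneg_of_isMinOn {φ : ℝ → ℝ} (hφ : ContDiff ℝ 2 φ) (hmin : ∀ t, φ 0 ≤ φ t) : 0 ≤ iteratedDeriv 2 φ 0 := by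
  by_contra hneg
  rw [not_le] at hneg
  -- regularity
  have hd1 : Differentiable ℝ φ := hφ.differentiable (by norm_num)
  have hd2 : Differentiable ℝ (deriv φ) := by
    have hφ' : ContDiff ℝ ((1 : ℕ) + 1 : ℕ) φ := hφ
    have h := ContDiff.differentiable_iteratedDeriv' (f := φ) 1 hφ'
    rwa [iteratedDeriv_one] at h
  have hcont2 : Continuous (iteratedDeriv 2 φ) := hφ.continuous_iteratedDeriv' 2
  have hdd : ∀ t, deriv (deriv φ) t = iteratedDeriv 2 φ t := fun t => by
    rw [show (2 : ℕ) = 1 + 1 from rfl, iteratedDeriv_succ', iteratedDeriv_one]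
  -- `φ′(0) = 0`
  have hloc : IsLocalMin φ 0 := Filter.Eventually.of_forall fun t => hmin t
  have hφ'0 : deriv φ 0 = 0 := hloc.deriv_eq_zero
  -- `φ″ < 0` on `(-δ, δ)`
  obtain ⟨δ, hδ, hnegI⟩ : ∃ δ > 0, ∀ t, |t| < δ → iteratedDeriv 2 φ t < 0 := by
    have hopen : IsOpen {t : ℝ | iteratedDeriv 2 φ t < 0} := isOpen_lt hcont2 continuous_const
    obtain ⟨δ, hδ, hball⟩ := Metric.isOpen_iff.1 hopen 0 hneg
    exact ⟨δ, hδ, fun t ht => hball (by simpa [Real.dist_eq] using ht)⟩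
  -- two mean-value steps on `[0, δ/2]`
  set t : ℝ := δ / 2 with ht
  have ht0 : 0 < t := by rw [ht]; linarith
  have htδ : t < δ := by rw [ht]; linarith
  obtain ⟨ξ, hξ, hslope⟩ := exists_deriv_eq_slope φ ht0 hd1.continuous.continuousOn (hd1.differentiableOn)
  obtain ⟨ζ, hζ, hslope'⟩ := exists_deriv_eq_slope (deriv φ) hξ.1 hd2.continuous.continuousOn (hd2.differentiableOn)
  rw [hdd, hφ'0, sub_zero, sub_zero] at hslope'
  have hζδ : |ζ| < δ := by rw [abs_of_pos hζ.1]; linarith [hζ.2, hξ.2]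
  have hneg2 := hnegI ζ hζδ
  -- `φ′(ξ) = φ″(ζ)·ξ < 0` and `φ(t) − φ(0) = φ′(ξ)·t < 0`
  have hφ'ξ : deriv φ ξ = iteratedDeriv 2 φ ζ * ξ := by
    rw [hslope', div_mul_cancel₀ _ hξ.1.ne']
  have hφ'neg : deriv φ ξ < 0 := by rw [hφ'ξ]; exact mul_neg_of_neg_of_pos hneg2 hξ.1
  have hdiff : φ t - φ 0 = deriv φ ξ * t := by
    rw [sub_zero] at hslope; rw [hslope]; field_simp
  have hlt : φ t < φ 0 := by nlinarith
  exact absurd (hmin t) (not_le.2 hlt)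

/-! ## §2 The Hessian floor from a pointwise floor -/

variable {V : Type*} [NormedAddCommGroup V] [NormedSpace ℝ V]

/-- ★★ **A POINTWISE FLOOR THAT TOUCHES IS A HESSIAN FLOOR**: if `F, g : V → ℝ` are `C²`, `g ≤ F` everywhere and `g x₀ = F x₀`, then for every `v`
`D²g(x₀)[v,v] ≤ D²F(x₀)[v,v]` (the difference `F − g ≥ 0` has a minimum at `x₀`; §1 along the line `x₀ + t v`, ✓`iteratedDeriv_lineRestriction`). [folklore] -/
theorem hessianForm_le_of_le_of_eq {F g : V → ℝ} (hF : ContDiff ℝ 2 F) (hg : ContDiff ℝ 2 g) (hle : ∀ x, g x ≤ F x) {x₀ : V} (heq : g x₀ = F x₀) (v : V) :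
    iteratedFDeriv ℝ 2 g x₀ (fun _ => v) ≤ iteratedFDeriv ℝ 2 F x₀ (fun _ => v) := by
  have hh : ContDiff ℝ 2 (fun x => F x - g x) := hF.sub hg
  set φ : ℝ → ℝ := fun t => F (x₀ + t • v) - g (x₀ + t • v) with hφ
  have hφc : ContDiff ℝ 2 φ := hh.comp (contDiff_const.add (contDiff_id.smul contDiff_const))
  have hmin : ∀ t, φ 0 ≤ φ t := fun t => by
    simp only [hφ, zero_smul, add_zero]
    have := hle (x₀ + t • v); rw [heq]; linarith
  have h2 := iteratedDeriv_two_nonneg_of_isMinOn hφc hmin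
  have e := Literature.Analysis.Calculus.iteratedDeriv_lineRestriction (n := 2) hh x₀ v 0
  rw [zero_smul, add_zero] at e
  have hsub : iteratedFDeriv ℝ 2 (fun x => F x - g x) x₀ (fun _ => v) = iteratedFDeriv ℝ 2 F x₀ (fun _ => v) - iteratedFDeriv ℝ 2 g x₀ (fun _ => v) := by
    rw [show (fun x => F x - g x) = F - g from rfl, iteratedFDeriv_sub (hF.of_le le_rfl) (hg.of_le le_rfl)]; rfl
  have : 0 ≤ iteratedFDeriv ℝ 2 F x₀ (fun _ => v) - iteratedFDeriv ℝ 2 g x₀ (fun _ => v) := by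
    rw [← hsub, ← e]; exact h2
  linarith

/-! ## §3 Local versions and the Hessian of a quadratic along a line -/

/-- ★ LOCAL version of §1: a `C²` function with a LOCAL minimum at `0` (`φ 0 ≤ φ t` for `|t| < ρ`) has `iteratedDeriv 2 φ 0 ≥ 0`. [folklore] -/
theorem iteratedDeriv_two_nonneg_of_isLocalMin {φ : ℝ → ℝ} (hφ : ContDiff ℝ 2 φ) {ρ : ℝ} (hρ : 0 < ρ) (hmin : ∀ t, |t| < ρ → φ 0 ≤ φ t) :
    0 ≤ iteratedDeriv 2 φ 0 := by
  by_contra hneg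
  rw [not_le] at hneg
  have hd1 : Differentiable ℝ φ := hφ.differentiable (by norm_num)
  have hd2 : Differentiable ℝ (deriv φ) := by
    have hφ' : ContDiff ℝ ((1 : ℕ) + 1 : ℕ) φ := hφ
    have h := ContDiff.differentiable_iteratedDeriv' (f := φ) 1 hφ'
    rwa [iteratedDeriv_one] at h
  have hcont2 : Continuous (iteratedDeriv 2 φ) := hφ.continuous_iteratedDeriv' 2
  have hdd : ∀ t, deriv (deriv φ) t = iteratedDeriv 2 φ t := fun t => by
    rw [show (2 : ℕ) = 1 + 1 from rfl, iteratedDeriv_succ', iteratedDeriv_one]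
  have hloc : IsLocalMin φ 0 := by
    have hball : Metric.ball (0 : ℝ) ρ ∈ nhds (0 : ℝ) := Metric.ball_mem_nhds 0 hρ
    filter_upwards [hball] with t ht
    exact hmin t (by simpa [Real.dist_eq] using ht)
  have hφ'0 : deriv φ 0 = 0 := hloc.deriv_eq_zero
  obtain ⟨δ, hδ, hnegI⟩ : ∃ δ > 0, ∀ t, |t| < δ → iteratedDeriv 2 φ t < 0 := by
    have hopen : IsOpen {t : ℝ | iteratedDeriv 2 φ t < 0} := isOpen_lt hcont2 continuous_const
    obtain ⟨δ, hδ, hball⟩ := Metric.isOpen_iff.1 hopen 0 hneg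
    exact ⟨δ, hδ, fun t ht => hball (by simpa [Real.dist_eq] using ht)⟩
  set t : ℝ := min δ ρ / 2 with ht
  have hm0 : 0 < min δ ρ := lt_min hδ hρ
  have ht0 : 0 < t := by rw [ht]; linarith
  have htδ : t < δ := by rw [ht]; linarith [min_le_left δ ρ]
  have htρ : t < ρ := by rw [ht]; linarith [min_le_right δ ρ]
  obtain ⟨ξ, hξ, hslope⟩ := exists_deriv_eq_slope φ ht0 hd1.continuous.continuousOn (hd1.differentiableOn)
  obtain ⟨ζ, hζ, hslope'⟩ := exists_deriv_eq_slope (deriv φ) hξ.1 hd2.continuous.continuousOn (hd2.differentiableOn)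
  rw [hdd, hφ'0, sub_zero, sub_zero] at hslope'
  have hζδ : |ζ| < δ := by rw [abs_of_pos hζ.1]; linarith [hζ.2, hξ.2]
  have hneg2 := hnegI ζ hζδ
  have hφ'ξ : deriv φ ξ = iteratedDeriv 2 φ ζ * ξ := by
    rw [hslope', div_mul_cancel₀ _ hξ.1.ne']
  have hφ'neg : deriv φ ξ < 0 := by rw [hφ'ξ]; exact mul_neg_of_neg_of_pos hneg2 hξ.1
  have hdiff : φ t - φ 0 = deriv φ ξ * t := by
    rw [sub_zero] at hslope; rw [hslope]; field_simp
  have hlt : φ t < φ 0 := by nlinarith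
  exact absurd (hmin t (by rw [abs_of_pos ht0]; exact htρ)) (not_le.2 hlt)

/-- ★★ LOCAL **POINTWISE FLOOR ⇒ HESSIAN FLOOR along a direction**: `F, g` of class `C²`, `g(x₀ + t v) ≤ F(x₀ + t v)` for `|t| < ρ` and `g x₀ = F x₀` give
`D²g(x₀)[v,v] ≤ D²F(x₀)[v,v]`. [folklore] -/
theorem hessianForm_le_of_le_near {F g : V → ℝ} (hF : ContDiff ℝ 2 F) (hg : ContDiff ℝ 2 g) {x₀ v : V} {ρ : ℝ} (hρ : 0 < ρ)
    (hle : ∀ t : ℝ, |t| < ρ → g (x₀ + t • v) ≤ F (x₀ + t • v)) (heq : g x₀ = F x₀) :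
    iteratedFDeriv ℝ 2 g x₀ (fun _ => v) ≤ iteratedFDeriv ℝ 2 F x₀ (fun _ => v) := by
  have hh : ContDiff ℝ 2 (fun x => F x - g x) := hF.sub hg
  set φ : ℝ → ℝ := fun t => F (x₀ + t • v) - g (x₀ + t • v) with hφ
  have hφc : ContDiff ℝ 2 φ := hh.comp (contDiff_const.add (contDiff_id.smul contDiff_const))
  have hmin : ∀ t, |t| < ρ → φ 0 ≤ φ t := fun t ht => by
    simp only [hφ, zero_smul, add_zero]
    have := hle t ht; rw [heq]; linarith
  have h2 := iteratedDeriv_two_nonneg_of_isLocalMin hφc hρ hmin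
  have e := Literature.Analysis.Calculus.iteratedDeriv_lineRestriction (n := 2) hh x₀ v 0
  rw [zero_smul, add_zero] at e
  have hsub : iteratedFDeriv ℝ 2 (fun x => F x - g x) x₀ (fun _ => v) = iteratedFDeriv ℝ 2 F x₀ (fun _ => v) - iteratedFDeriv ℝ 2 g x₀ (fun _ => v) := by
    rw [show (fun x => F x - g x) = F - g from rfl, iteratedFDeriv_sub (hF.of_le le_rfl) (hg.of_le le_rfl)]; rfl
  have : 0 ≤ iteratedFDeriv ℝ 2 F x₀ (fun _ => v) - iteratedFDeriv ℝ 2 g x₀ (fun _ => v) := by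
    rw [← hsub, ← e]; exact h2
  linarith

/-- ★ **THE HESSIAN OF A FUNCTION THAT IS QUADRATIC ALONG A LINE**: if `g` is `C²` and `g(x₀ + t v) = g x₀ + c·t²` for all `t`, then `D²g(x₀)[v,v] = 2c`. [folklore] -/
theorem hessianForm_eq_of_sq_line {g : V → ℝ} (hg : ContDiff ℝ 2 g) {x₀ v : V} {c : ℝ} (hline : ∀ t : ℝ, g (x₀ + t • v) = g x₀ + c * t ^ 2) :
    iteratedFDeriv ℝ 2 g x₀ (fun _ => v) = 2 * c := by
  have e := Literature.Analysis.Calculus.iteratedDeriv_lineRestriction (n := 2) hg x₀ v 0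
  rw [zero_smul, add_zero] at e
  rw [← e, show (fun s : ℝ => g (x₀ + s • v)) = fun s => g x₀ + c * s ^ 2 from funext hline]
  rw [show (2 : ℕ) = 1 + 1 from rfl, iteratedDeriv_succ, iteratedDeriv_one]
  have hd1 : ∀ s : ℝ, HasDerivAt (fun s : ℝ => g x₀ + c * s ^ 2) (c * (2 * s)) s := fun s => by
    have h := ((hasDerivAt_pow 2 s).const_mul c).const_add (g x₀)
    simpa using h
  have h1 : deriv (fun s : ℝ => g x₀ + c * s ^ 2) = fun s => c * (2 * s) := funext fun s => (hd1 s).deriv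
  have hd2 : HasDerivAt (fun s : ℝ => c * (2 * s)) (c * 2) 0 := by
    have h := ((hasDerivAt_id (0 : ℝ)).const_mul 2).const_mul c
    simpa using h
  rw [h1, hd2.deriv]
  ring

end Summit.QuantumFields.YangMills.Theorems.QuantitativeLaplace

end
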